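import Summits.BirchSwinnertonDyer.Rank1Residual.Supersingular.SignedRankOneCorA5
import Summits.BirchSwinnertonDyer.Rank1Residual.Partition.Rows
import HarnessLib

/-!
# Row C3 (Jetchev–Skinner–Wan 2017) on its SUPERSINGULAR sub-case at main-conjecture level: the typed
# signed main conjecture for one sign + the Burungale–Kobayashi–Ota Cor. A.5 rank-one link ⇒ BSD(E,p)
# (cell `b2b-bsdres`, GLUE seat gen 4; companion of `Partition/MainConjecturesCMSupersingular.lean`)

HONEST FRAMING (cell `b2b-bsdres`, run/shared/lean/b2b/bsd-rank1-residual/, verbatim in every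
file): the goal of the cell is to DELETE the COMBINATION-SHAPED residual classes of the
Birch–Swinnerton-Dyer formula for ALL analytic-rank `≤ 1` elliptic curves over `ℚ` — "full BSD
formula for every rank `≤ 1` curve in class `C`" assembled STRICTLY from published theorems — so
that the rank-`≤ 1` remainder becomes exactly the CONSTRUCTION-SHAPED classes, which are TYPED
(missing-input `Prop`s), NOT attempted. This is not "finishing BSD". NEW WORK of the cell
(bookkeeping over decls already in the tree), hence under `Summits/`; NO named fact, NO definition.
Research routes; no claim beyond the stated row and locus; nothing booked; no label moves.

The GLUE table (`HOME/b2b-bsdres-lit-glue/GLUE.md` §2) binds the covered rows of RESIDUAL-CASES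
§a.1 to "(main conjecture, as typed) + (control, as typed) ⇒ BSD(E,p)". Row **C3** (JSW 2017 Thm.
1.2.1: `r_an = 1`, semistable, good `p`, irreducible, `p ≥ 5 ∨ (p = 3 ∧ (ordinary ∨ a_3 = 0))`) was
bound on its ORDINARY part (gens 0–3: STEP L / anticyclotomic links + the cyclotomic main conjecture
of the twist) and its SUPERSINGULAR sub-case (`p ∣ a_p`; in print the `JSW-ss` branch, PUB\*) was
recorded as "NOT covered by this skeleton (needs the ± STEP L)". Since then the supersingular family
(prover B, `additive-p3` gen 13) landed the MAIN-CONJECTURE-LEVEL rank-one link at `a_p = 0`: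
`Supersingular.bsdp_of_kobayashiMainConjecture_of_corA5_of_analyticRank_eq_one` (ONE typed input
`KobayashiMainConjecture W p ε` + the PUBLISHED reading-fact Burungale–Kobayashi–Ota 2024 App. A
Cor. A.5 ∘ Kobayashi 2003 Thm. 7.4 + modularity + GZK ⇒ `BSDp W p`). This file only NAMES that
object for the row:

* `RowC3.frobeniusTrace_eq_zero_of_dvd`, `RowC3.ne_two`, `RowC3.classX6_of_dvd` — a row-C3 pair with
  `p ∣ a_p` has `a_p = 0` (Hasse at `p ≥ 5`; the row's own clause at `p = 3`) and satisfies the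
  defining predicate of class X6 (`ss(p) ∧ sst ∧ (p ≥ 5 ∨ a_3 = 0)`) — the sub-locus where JSW-ss
  (PUB\*) pre-empts X6 in the Partition;
* **`RowC3.bsdp_rankOne_ss_of_kobayashiMainConjecture_of_corA5`** — C3 ∩ {`p ∣ a_p`} at MC level:
  the typed `Supersingular.KobayashiMainConjecture W p ε` for ONE sign (for non-CM `E` this is NOT a
  published theorem: Kobayashi 2003's conjecture; announced for semistable `E` by BSTW
  arXiv:2409.01350 Thm. 1.3, PRE; a theorem for CM `E` by Pollack–Rubin 2004 — but CM curves are never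
  semistable, so not on row C3) + Cor. A.5 + modularity + GZK ⇒ `BSDp W p`;
* `RowC3.bsdp_rankOne_ss_of_BSTW13_OPEN_of_corA5` — the same with the typed input supplied by the
  ANNOUNCED BSTW Thm. 1.3 taken as an explicit OPEN hypothesis (never a theorem): the kernel referees
  "BSTW Thm. 1.3 ⇒ the supersingular case of JSW Thm. 1.2.1 from published results".

Row C3 stays COVERED in print by JSW Thm. 1.2.1 (`RowC3.bsdp` ←
`JetchevSkinnerWan2017.thm121_padicValRat_bsd_rank_one`, flag `JSW-ss` on this sub-case); this
file changes no label and books nothing. With it every covered row of §a.1 has, on every sub-locus,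
a kernel object of the brief's shape (GLUE.md GEN 4 addendum §G4.3).

References: Jetchev–Skinner–Wan, Camb. J. Math. 5 (2017) Thm. 1.2.1 [JetchevSkinnerWan2017];
Burungale–Kobayashi–Ota, JIMJ 23 (2024) App. A Cor. A.5 [BurungaleKobayashiOta2023]; Kobayashi,
Invent. Math. 152 (2003) Conjecture (p. 2), Thm. 7.4 [Kobayashi2003]; Burungale–Skinner–Tian–Wan
arXiv:2409.01350v2 Thm. 1.3 (PRE) [BurungaleSkinnerTianWan2024]; Serre 1981 §8 [Serre1981];
Miller 2011 Def. 1.1 [Miller2011LMS]; RESIDUAL-CASES.md §a.1 row C3, §a.2 row X6.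
-/

set_option autoImplicit false

noncomputable section

open scoped Classical

open WeierstrassCurve Literature.NumberTheory.EllipticCurves
  Literature.NumberTheory.EllipticCurves.Rank1Residual
  Literature.NumberTheory.EllipticCurves.BurungaleKobayashiOta2024

namespace Summit.BirchSwinnertonDyer.Rank1Residual

variable {W : WeierstrassCurve ℚ} [W.IsElliptic] [W.IsGloballyMinimal] {p : ℕ} [Fact p.Prime]

omit [W.IsElliptic] in
/-- A row-C3 prime is odd (`p ≥ 5` or `p = 3`). [cite: JetchevSkinnerWan2017, Thm. 1.2.1 (§1.2)] -/
theorem RowC3.ne_two (h : RowC3 W p) : p ≠ 2 := by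
  rcases h.2.2.2.2 with h5 | ⟨h3, -⟩ <;> omega

/-- **A row-C3 pair with `p ∣ a_p` has `a_p = 0`**: at `p ≥ 5` by Hasse
(`natCast_dvd_frobeniusTrace_iff_eq_zero`), at `p = 3` by the row's clause "ordinary or `a_3 = 0`"
(ordinary contradicts `3 ∣ a_3`). [cite: JetchevSkinnerWan2017, Thm. 1.2.1 (§1.2)]
[cite: Serre1981, §8.1–8.2 (pp. 188–189)] -/
theorem RowC3.frobeniusTrace_eq_zero_of_dvd (h : RowC3 W p) (hss : (p : ℤ) ∣ W.frobeniusTrace p) :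
    W.frobeniusTrace p = 0 := by
  obtain ⟨-, -, hgood, -, h5⟩ := h
  rcases h5 with h5 | ⟨h3, hord | h0⟩
  · exact (W.natCast_dvd_frobeniusTrace_iff_eq_zero p h5 hgood).mp hss
  · exact absurd hss hord.2
  · subst h3; exact h0

/-- **C3 ∩ {`p ∣ a_p`} lies in the defining predicate of class X6** (`ss(p) ∧ sst ∧ (p ≥ 5 ∨ a_3 = 0)`):
the sub-locus where the Partition files the pair under the covered row C3 (JSW-ss, PUB\*) rather
than under X6. Bookkeeping. [cite: JetchevSkinnerWan2017, Thm. 1.2.1 (§1.2)] -/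
theorem RowC3.classX6_of_dvd (h : RowC3 W p) (hss : (p : ℤ) ∣ W.frobeniusTrace p) :
    ClassX6 W p := by
  refine ⟨⟨h.2.2.1, hss⟩, h.2.1, ?_⟩
  rcases h.2.2.2.2 with h5 | ⟨h3, -⟩
  · exact Or.inl h5
  · subst h3
    exact Or.inr (RowC3.frobeniusTrace_eq_zero_of_dvd h hss)

/-- **C3 ∩ {`p ∣ a_p`} (the supersingular sub-case, flag `JSW-ss`) at main-conjecture level.** For a
row-C3 pair (`ord_{s=1}L(E,s) = 1`, `E` semistable, `p` good, `E[p]` irreducible, `p ≥ 5` or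
`p = 3` with `a_3 = 0` here) with `p` supersingular: ONE typed input — Kobayashi's signed main
conjecture for one sign `ε`, `Supersingular.KobayashiMainConjecture W p ε` (NOT a published theorem
for non-CM `E`; announced for semistable `E`, BSTW Thm. 1.3, PRE) — + the PUBLISHED rank-one link
Burungale–Kobayashi–Ota 2024 App. A Cor. A.5 ∘ Kobayashi 2003 Thm. 7.4 (`hA5`, named reading-fact
`corA5_pPart_of_signedCharIdeal_eq`) + modularity (`hmod`) + GZK (`hGZK`) ⇒ `BSD(E,p)`, via prover
B's `Supersingular.X6.bsdp_of_kobayashiMainConjecture_of_corA5_of_analyticRank_eq_one` on the X6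
predicate (`RowC3.classX6_of_dvd`). Semistability and irreducibility are not used by the link (Cor.
A.5 is level- and image-free); they are the row's. The MC-level pointer for C3's supersingular part;
row C3 stays COVERED by JSW Thm. 1.2.1; nothing booked. [cite: JetchevSkinnerWan2017, Thm. 1.2.1 (§1.2)]
[cite: BurungaleKobayashiOta2023, App. A Cor. A.5] [cite: Kobayashi2003, Thm. 7.4 (p. 13) and Conjecture (p. 2)]
[cite: Miller2011LMS, §1 and Def. 1.1] -/
theorem RowC3.bsdp_rankOne_ss_of_kobayashiMainConjecture_of_corA5
    (hA5 : corA5_pPart_of_signedCharIdeal_eq) (hmod : hasEntireLFunction_rat)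
    (hGZK : rank_eq_analyticRank_of_analyticRank_le_one)
    (h : RowC3 W p) (hss : (p : ℤ) ∣ W.frobeniusTrace p) (ε : ℤˣ)
    (hMC : Supersingular.KobayashiMainConjecture W p ε) : BSDp W p :=
  Supersingular.X6.bsdp_of_kobayashiMainConjecture_of_corA5_of_analyticRank_eq_one W p hA5 hmod hGZK
    (RowC3.ne_two h) (RowC3.classX6_of_dvd h hss) h.1 ε hMC

/-- **C3 ∩ {`p ∣ a_p`} under the ANNOUNCED BSTW Thm. 1.3 (OPEN hypothesis, preprint
arXiv:2409.01350v2 — NEVER a theorem) + the Cor. A.5 fact**: the kernel referees "BSTW Thm. 1.3 ⇒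
the supersingular case of JSW Thm. 1.2.1" — granted the announced signed main conjecture for
semistable `E`, the rank-one `p`-part on C3's supersingular sub-case follows from PUBLISHED results
alone (Cor. A.5 ∘ Kobayashi Thm. 7.4, modularity, GZK). [claim: BurungaleSkinnerTianWan2024, status: under-review]
[cite: BurungaleKobayashiOta2023, App. A Cor. A.5] [cite: JetchevSkinnerWan2017, Thm. 1.2.1 (§1.2)] -/
theorem RowC3.bsdp_rankOne_ss_of_BSTW13_OPEN_of_corA5
    (hBSTW : Supersingular.BurungaleSkinnerTianWan2024_thm13_OPEN)
    (hA5 : corA5_pPart_of_signedCharIdeal_eq) (hmod : hasEntireLFunction_rat)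
    (hGZK : rank_eq_analyticRank_of_analyticRank_le_one)
    (h : RowC3 W p) (hss : (p : ℤ) ∣ W.frobeniusTrace p) : BSDp W p :=
  Supersingular.X6.bsdp_of_BSTW13_OPEN_of_corA5_of_analyticRank_eq_one W p hBSTW hA5 hmod hGZK
    (RowC3.ne_two h) (RowC3.classX6_of_dvd h hss) h.1

end Summit.BirchSwinnertonDyer.Rank1Residual

end
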